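import Summits.AtomisticToContinuum.FouriersLaw.Theorems.EmbeddedDrudeMourreDrudeDissolutionStubFreeForceKernel
import Summits.AtomisticToContinuum.FouriersLaw.Theorems.EmbeddedDrudeMourreDrudeDissolutionStubPencilDerivation
import Summits.AtomisticToContinuum.FouriersLaw.Theorems.EmbeddedDrudeMourreDrudeDissolutionStubGramContinuity
import Summits.AtomisticToContinuum.FouriersLaw.Theorems.EmbeddedDrudeMourreDrudeDissolutionStubPolynomialStationarity
import Summits.AtomisticToContinuum.FouriersLaw.Theorems.DrudeDissolution.Negative.WeakAnharmonicityForm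
import Summits.AtomisticToContinuum.FouriersLaw.Theorems.EmbeddedDrudeMourreMourreDissolutionSpectralWindow
import Summits.AtomisticToContinuum.FouriersLaw.Theorems.EmbeddedDrudeMourreFGRGap
import Summits.AtomisticToContinuum.FouriersLaw.Theses.EmbeddedDrudeMourre
import HarnessLib

/-!
# Crux `EmbeddedDrudeMourre.DrudeDissolution` from the engine alone (line `gram-pencil-harmonic-chaos`)
(item stmt-AtomisticToContinuum-12593; `--supports` file; lead c11)

WHAT. With stubs F (`stub_pencilFramework`), C (`stub_pencilDerivation`), G (`stub_gramContinuity`),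
S (`stub_polynomialStationarity`) and K (`stub_freeForceKernel`) of the line all landed as theorems, the crux
`DrudeDissolution` follows from the line's one remaining stub E (`stub_pencilDissolution`, the engine: Abelian limiting
absorption at frequency `0` for the current of `pinnedChain ω₂ (aε) (bε) 1`, locally uniformly on a window) —
`DrudeDissolution_of_pencilDissolution` takes E verbatim as registered (`F → C → G → S → K → core`), and
`DrudeDissolution_of_engine` takes only its analytic core.

HOW. The composition `DrudeDissolution_of` of the registered skeleton: weak-anharmonicity form of the crux
(`Negative.drudeDissolution_iff_weak_anharmonicity`), `HasOddSectorGap` from the proved crux FGRGap (`FGRGap_proof`),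
F's datum at coupling `(aε, bε)`, E's window, and the Bochner/Fejér spectral-window lemma
`MourreDissolution.stub_spectralWindow` for the continuous, even, positive-definite current autocorrelation.
-/

noncomputable section

namespace Summit.AtomisticToContinuum.FouriersLaw.Theorems.DrudeDissolution.GramPencilHarmonicChaos

open MeasureTheory Filter Set Function Topology
open scoped InnerProductSpace ENNReal ComplexConjugate
open Literature.MathematicalPhysics.KineticTheory
open Literature.MathematicalPhysics.KineticTheory.HeatConduction
open Literature.MathematicalPhysics.KineticTheory.PhononBoltzmann
open HarmonicChaos ProbabilityTheory
open PinnedChainKinetic (𝕋 𝕋3 μ𝕋 μ𝕋3 k₄ sinT)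
open scoped Literature.MathematicalPhysics.KineticTheory.HeatConduction.PinnedChainKinetic

/-- **The crux from the engine stub E, verbatim** (`stub_pencilDissolution` of line `gram-pencil-harmonic-chaos`, stated with
its hypotheses F, C, G, S, K expanded exactly as registered): E → `DrudeDissolution`. -/
theorem DrudeDissolution_of_pencilDissolution :
    ((∀ ω₂ lam β : ℝ, 0 < ω₂ → 0 ≤ lam → 0 ≤ β →
      ∃ (D : InfiniteChainDynamics (pinnedChain ω₂ lam β 1))
        (Z : ZeroWavenumberData (pinnedChain ω₂ lam β 1) D),
          (pinnedChain ω₂ lam β 1).IsChainGibbsMeasure 1 Z.μ ∧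
          D.carrier = (pinnedChain ω₂ lam β 1).bmGood ∧
          (∀ t : ℝ, Measurable (D.flow t)) ∧
          (∀ (t : ℝ) (σ : ChainConfig), σ ∉ (pinnedChain ω₂ lam β 1).bmGood → D.flow t σ = σ) ∧
          (∀ (t : ℝ) (x : ℤ), D.flow t ∘ chainShift x = chainShift x ∘ D.flow t) ∧
          (∀ t : ℝ, (fun (σ : ChainConfig) (i : ℤ) => σ (-i)) ∘ D.flow t = D.flow t ∘ (fun (σ : ChainConfig) (i : ℤ) => σ (-i))) ∧
          MeasureTheory.MeasurePreserving (fun (σ : ChainConfig) (i : ℤ) => σ (-i)) Z.μ Z.μ ∧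
          Z.HasMomentumReversal ∧
          Z.toFluctuationDynamics.IsStronglyContinuous ∧
          Z.localObs = Submodule.span ℝ {w : ChainConfig → ℝ | ∃ u ∈ Algebra.adjoin ℝ (Set.range fun xc : ℤ × Bool => fun σ : ChainConfig => if xc.2 then (σ xc.1).2 else (σ xc.1).1), ∃ s : ℝ, w = u ∘ D.flow s}) →
    ((∀ ω₂ lam β γ : ℝ, ∀ u ∈ Algebra.adjoin ℝ (Set.range fun xc : ℤ × Bool => fun σ : ChainConfig => if xc.2 then (σ xc.1).2 else (σ xc.1).1),
        liouvilleZ (pinnedChain ω₂ lam β γ) u ∈ Algebra.adjoin ℝ (Set.range fun xc : ℤ × Bool => fun σ : ChainConfig => if xc.2 then (σ xc.1).2 else (σ xc.1).1)) ∧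
      ∀ ω₂ lam β : ℝ, 0 < ω₂ → 0 ≤ lam → 0 ≤ β →
        ∀ (D : InfiniteChainDynamics (pinnedChain ω₂ lam β 1)) (Z : ZeroWavenumberData (pinnedChain ω₂ lam β 1) D),
          (pinnedChain ω₂ lam β 1).IsChainGibbsMeasure 1 Z.μ →
          D.carrier = (pinnedChain ω₂ lam β 1).bmGood →
          (∀ (t : ℝ) (σ : ChainConfig), σ ∉ (pinnedChain ω₂ lam β 1).bmGood → D.flow t σ = σ) →
          Z.toFluctuationDynamics.IsStronglyContinuous →
          Z.localObs = Submodule.span ℝ {w : ChainConfig → ℝ | ∃ u ∈ Algebra.adjoin ℝ (Set.range fun xc : ℤ × Bool => fun σ : ChainConfig => if xc.2 then (σ xc.1).2 else (σ xc.1).1), ∃ s : ℝ, w = u ∘ D.flow s} →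
          (∀ u ∈ Algebra.adjoin ℝ (Set.range fun xc : ℤ × Bool => fun σ : ChainConfig => if xc.2 then (σ xc.1).2 else (σ xc.1).1),
            HasDerivAt (fun t : ℝ => (Z.koopman t (Z.fluct u) : ZeroWavenumberSpace Z))
              (Z.fluct (liouvilleZ (pinnedChain ω₂ lam β 1) u)) 0) ∧
          Z.generator.HasCore
            (Submodule.span ℝ {ψ : ZeroWavenumberSpace Z | ∃ w ∈ Z.localObs, ψ = Z.fluct w})) →
    (∀ ω₂ a b : ℝ, 0 < ω₂ → 0 ≤ a → 0 ≤ b → ∀ μ : ℝ → MeasureTheory.Measure ChainConfig,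
      (∀ ε ∈ Set.Icc (0 : ℝ) 1, (pinnedChain ω₂ (a * ε) (b * ε) 1).IsChainGibbsMeasure 1 (μ ε) ∧ IsShiftInvariant (μ ε)) →
      ∀ u ∈ Algebra.adjoin ℝ (Set.range fun xc : ℤ × Bool => fun σ : ChainConfig => if xc.2 then (σ xc.1).2 else (σ xc.1).1),
      ∀ v ∈ Algebra.adjoin ℝ (Set.range fun xc : ℤ × Bool => fun σ : ChainConfig => if xc.2 then (σ xc.1).2 else (σ xc.1).1),
        (∃ M : ℝ, ∀ ε ∈ Set.Icc (0 : ℝ) 1, MeasureTheory.MemLp u 2 (μ ε) ∧ ∫ σ, (u σ) ^ 2 ∂(μ ε) ≤ M) ∧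
        (∃ C : ℝ, ∀ ε ∈ Set.Icc (0 : ℝ) 1,
          Summable (fun x : ℤ => |ProbabilityTheory.covariance u (v ∘ chainShift x) (μ ε)|) ∧
          ∑' x : ℤ, |ProbabilityTheory.covariance u (v ∘ chainShift x) (μ ε)| ≤ C) ∧
        ContinuousOn (fun ε : ℝ => ∑' x : ℤ, ProbabilityTheory.covariance u (v ∘ chainShift x) (μ ε))
          (Set.Icc (0 : ℝ) 1)) →
    (∀ ω₂ lam β γ T : ℝ, 0 < ω₂ → 0 ≤ lam → 0 ≤ β → 0 < T →
      ∀ μ : MeasureTheory.Measure ChainConfig,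
        (pinnedChain ω₂ lam β γ).IsChainGibbsMeasure T μ → IsShiftInvariant μ →
        ∀ f ∈ Algebra.adjoin ℝ (Set.range fun xc : ℤ × Bool => fun σ : ChainConfig => if xc.2 then (σ xc.1).2 else (σ xc.1).1),
          MeasureTheory.Integrable (liouvilleZ (pinnedChain ω₂ lam β γ) f) μ ∧
          ∫ σ, liouvilleZ (pinnedChain ω₂ lam β γ) f σ ∂μ = 0) →
    (∀ ω₂ a b : ℝ, 0 < ω₂ → 0 < a → 0 < b → HasOddSectorGap ω₂ a b →
      ∀ (D₀ : InfiniteChainDynamics (pinnedChain ω₂ 0 0 1)) (Z₀ : ZeroWavenumberData (pinnedChain ω₂ 0 0 1) D₀),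
        (pinnedChain ω₂ 0 0 1).IsChainGibbsMeasure 1 Z₀.μ →
        D₀.carrier = (pinnedChain ω₂ 0 0 1).bmGood →
        Z₀.toFluctuationDynamics.IsStronglyContinuous →
        (fun σ : ChainConfig => liouvilleZ (pinnedChain ω₂ a b 1) (fun σ => (pinnedChain ω₂ 0 0 1).bondCurrentZ σ 0) σ - liouvilleZ (pinnedChain ω₂ 0 0 1) (fun σ => (pinnedChain ω₂ 0 0 1).bondCurrentZ σ 0) σ + b * (liouvilleZ (pinnedChain ω₂ 0 0 1) (fun σ => (pinnedChain ω₂ 0 1 1).bondCurrentZ σ 0) σ - liouvilleZ (pinnedChain ω₂ 0 0 1) (fun σ => (pinnedChain ω₂ 0 0 1).bondCurrentZ σ 0) σ)) ∈ Z₀.localObs →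
        ∃ δ : ℝ, 0 < δ ∧ ∃ ρ : ℝ → ℝ, ContinuousOn ρ (Set.Ioo (-δ) δ) ∧ 0 < ρ 0 ∧
          TendstoLocallyUniformlyOn
            (fun (ν : ℝ) (ω : ℝ) => ∫ t in Set.Ioi (0 : ℝ), Real.exp (-(ν * t)) * (Real.cos (ω * t) *
              Z₀.form
                (fun σ : ChainConfig => liouvilleZ (pinnedChain ω₂ a b 1) (fun σ => (pinnedChain ω₂ 0 0 1).bondCurrentZ σ 0) σ - liouvilleZ (pinnedChain ω₂ 0 0 1) (fun σ => (pinnedChain ω₂ 0 0 1).bondCurrentZ σ 0) σ + b * (liouvilleZ (pinnedChain ω₂ 0 0 1) (fun σ => (pinnedChain ω₂ 0 1 1).bondCurrentZ σ 0) σ - liouvilleZ (pinnedChain ω₂ 0 0 1) (fun σ => (pinnedChain ω₂ 0 0 1).bondCurrentZ σ 0) σ))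
                ((fun σ : ChainConfig => liouvilleZ (pinnedChain ω₂ a b 1) (fun σ => (pinnedChain ω₂ 0 0 1).bondCurrentZ σ 0) σ - liouvilleZ (pinnedChain ω₂ 0 0 1) (fun σ => (pinnedChain ω₂ 0 0 1).bondCurrentZ σ 0) σ + b * (liouvilleZ (pinnedChain ω₂ 0 0 1) (fun σ => (pinnedChain ω₂ 0 1 1).bondCurrentZ σ 0) σ - liouvilleZ (pinnedChain ω₂ 0 0 1) (fun σ => (pinnedChain ω₂ 0 0 1).bondCurrentZ σ 0) σ)) ∘ D₀.flow t)))
            (fun ω => Real.pi * ρ ω) (𝓝[>] (0 : ℝ)) (Set.Ioo (-δ) δ)) →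
    ∀ ω₂ a b : ℝ, 0 < ω₂ → 0 < a → 0 < b → HasOddSectorGap ω₂ a b →
      ∃ ε₀ : ℝ, 0 < ε₀ ∧ ∀ ε : ℝ, 0 < ε → ε < ε₀ →
        ∀ (D : InfiniteChainDynamics (pinnedChain ω₂ (a * ε) (b * ε) 1))
          (Z : ZeroWavenumberData (pinnedChain ω₂ (a * ε) (b * ε) 1) D),
            (pinnedChain ω₂ (a * ε) (b * ε) 1).IsChainGibbsMeasure 1 Z.μ →
            D.carrier = (pinnedChain ω₂ (a * ε) (b * ε) 1).bmGood →
            (∀ t : ℝ, Measurable (D.flow t)) →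
            (∀ (t : ℝ) (σ : ChainConfig), σ ∉ (pinnedChain ω₂ (a * ε) (b * ε) 1).bmGood → D.flow t σ = σ) →
            (∀ (t : ℝ) (x : ℤ), D.flow t ∘ chainShift x = chainShift x ∘ D.flow t) →
            (∀ t : ℝ, (fun (σ : ChainConfig) (i : ℤ) => σ (-i)) ∘ D.flow t = D.flow t ∘ (fun (σ : ChainConfig) (i : ℤ) => σ (-i))) →
            MeasureTheory.MeasurePreserving (fun (σ : ChainConfig) (i : ℤ) => σ (-i)) Z.μ Z.μ →
            Z.HasMomentumReversal →
            Z.toFluctuationDynamics.IsStronglyContinuous →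
            Z.localObs = Submodule.span ℝ {w : ChainConfig → ℝ | ∃ u ∈ Algebra.adjoin ℝ (Set.range fun xc : ℤ × Bool => fun σ : ChainConfig => if xc.2 then (σ xc.1).2 else (σ xc.1).1), ∃ s : ℝ, w = u ∘ D.flow s} →
            ∃ δ : ℝ, 0 < δ ∧ ∃ g : ℝ → ℝ, ContinuousOn g (Set.Ioo (-δ) δ) ∧ 0 < g 0 ∧
              TendstoLocallyUniformlyOn
                (fun (ν : ℝ) (ω : ℝ) => ∫ t in Set.Ioi (0 : ℝ),
                  Real.exp (-(ν * t)) * (Real.cos (ω * t) * D.currentCorrelation Z.μ t))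
                (fun ω => Real.pi * g ω) (𝓝[>] (0 : ℝ)) (Set.Ioo (-δ) δ)) →
        Summit.AtomisticToContinuum.FouriersLaw.Theses.EmbeddedDrudeMourre.DrudeDissolution := by
  intro hE
  have hK := stub_freeForceKernel
  have hG := stub_gramContinuity
  have hF := stub_pencilFramework
  have hC := stub_pencilDerivation
  have hS := stub_polynomialStationarity
  rw [Summit.AtomisticToContinuum.FouriersLaw.Theorems.DrudeDissolution.Negative.drudeDissolution_iff_weak_anharmonicity]
  intro ω₂ a b hω ha hb
  -- the Fermi-golden-rule input of the route is PROVED (crux FGRGap, stmt-12595)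
  have hgap : HasOddSectorGap ω₂ a b :=
    Summit.AtomisticToContinuum.FouriersLaw.Theorems.FGRGap_proof ω₂ a b hω ha hb
  obtain ⟨ε₀, hε₀, hcore⟩ := hE hF hC hG hS hK ω₂ a b hω ha hb hgap
  refine ⟨ε₀, hε₀, fun ε hε hεlt => ?_⟩
  -- the pencil's datum at coupling (aε, bε), unit temperature
  obtain ⟨D, Z, hGibbs, hcar, hmeas, hid, hsh, hιflow, hιμ, hR, hsc, hobs⟩ :=
    hF ω₂ (a * ε) (b * ε) hω (mul_pos ha hε).le (mul_pos hb hε).le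
  obtain ⟨δ, hδ, g, hg, hg0, hconv⟩ :=
    hcore ε hε hεlt D Z hGibbs hcar hmeas hid hsh hιflow hιμ hR hsc hobs
  -- the current autocorrelation is continuous, even and positive-definite (tree, Bochner inputs)
  have hmean := Z.integral_bondCurrent_eq_zero hR
  have hkoop : Continuous fun t : ℝ => Z.koopman t Z.currentClass := hsc Z.currentClass
  have hinner : Continuous fun t : ℝ => ⟪Z.currentClass, Z.koopman t Z.currentClass⟫_ℝ :=
    continuous_const.inner hkoop
  have hCcont : Continuous (D.currentCorrelation Z.μ) := by
    have h := hinner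
    simp_rw [Z.inner_currentClass_koopman_eq_currentCorrelation' hR] at h
    exact h
  have heven : ∀ t : ℝ, D.currentCorrelation Z.μ (-t) = D.currentCorrelation Z.μ t :=
    fun t => Z.currentCorrelation_neg hR t
  have hpd : ∀ (n : ℕ) (c τ : Fin n → ℝ),
      0 ≤ ∑ i, ∑ j, c i * c j * D.currentCorrelation Z.μ (τ j - τ i) :=
    fun n c τ => Z.sum_mul_currentCorrelation_nonneg hR Finset.univ c τ
  obtain ⟨σ, hfin, hcos, hgnn, hwin⟩ :=
    Summit.AtomisticToContinuum.FouriersLaw.Theorems.MourreDissolution.stub_spectralWindow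
      (D.currentCorrelation Z.μ) hCcont heven hpd δ hδ g hg hconv
  exact ⟨Z.μ, D, hGibbs, Z.preservesMeasure, fun t => Z.hasAbsConvergentCorrelation hmean t,
    σ, hfin, hcos, δ, g, hδ, hg, hgnn, hg0, hwin⟩

/-- **The crux from the analytic core of the engine alone**: since F, C, G, S, K are theorems, the locally uniform
Abelian limiting absorption at frequency `0` for the current of the weakly anharmonic chains `pinnedChain ω₂ (aε) (bε) 1`
(all small `ε`, every admissible zero-wavenumber datum) implies `DrudeDissolution`. -/
theorem DrudeDissolution_of_engine :
    (∀ ω₂ a b : ℝ, 0 < ω₂ → 0 < a → 0 < b → HasOddSectorGap ω₂ a b →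
      ∃ ε₀ : ℝ, 0 < ε₀ ∧ ∀ ε : ℝ, 0 < ε → ε < ε₀ →
        ∀ (D : InfiniteChainDynamics (pinnedChain ω₂ (a * ε) (b * ε) 1))
          (Z : ZeroWavenumberData (pinnedChain ω₂ (a * ε) (b * ε) 1) D),
            (pinnedChain ω₂ (a * ε) (b * ε) 1).IsChainGibbsMeasure 1 Z.μ →
            D.carrier = (pinnedChain ω₂ (a * ε) (b * ε) 1).bmGood →
            (∀ t : ℝ, Measurable (D.flow t)) →
            (∀ (t : ℝ) (σ : ChainConfig), σ ∉ (pinnedChain ω₂ (a * ε) (b * ε) 1).bmGood → D.flow t σ = σ) →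
            (∀ (t : ℝ) (x : ℤ), D.flow t ∘ chainShift x = chainShift x ∘ D.flow t) →
            (∀ t : ℝ, (fun (σ : ChainConfig) (i : ℤ) => σ (-i)) ∘ D.flow t = D.flow t ∘ (fun (σ : ChainConfig) (i : ℤ) => σ (-i))) →
            MeasureTheory.MeasurePreserving (fun (σ : ChainConfig) (i : ℤ) => σ (-i)) Z.μ Z.μ →
            Z.HasMomentumReversal →
            Z.toFluctuationDynamics.IsStronglyContinuous →
            Z.localObs = Submodule.span ℝ {w : ChainConfig → ℝ | ∃ u ∈ Algebra.adjoin ℝ (Set.range fun xc : ℤ × Bool => fun σ : ChainConfig => if xc.2 then (σ xc.1).2 else (σ xc.1).1), ∃ s : ℝ, w = u ∘ D.flow s} →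
            ∃ δ : ℝ, 0 < δ ∧ ∃ g : ℝ → ℝ, ContinuousOn g (Set.Ioo (-δ) δ) ∧ 0 < g 0 ∧
              TendstoLocallyUniformlyOn
                (fun (ν : ℝ) (ω : ℝ) => ∫ t in Set.Ioi (0 : ℝ),
                  Real.exp (-(ν * t)) * (Real.cos (ω * t) * D.currentCorrelation Z.μ t))
                (fun ω => Real.pi * g ω) (𝓝[>] (0 : ℝ)) (Set.Ioo (-δ) δ)) →
        Summit.AtomisticToContinuum.FouriersLaw.Theses.EmbeddedDrudeMourre.DrudeDissolution :=
  fun hE => DrudeDissolution_of_pencilDissolution (fun _ _ _ _ _ => hE)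

end Summit.AtomisticToContinuum.FouriersLaw.Theorems.DrudeDissolution.GramPencilHarmonicChaos

end
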